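import Mathlib
import Summits.KontsevichZagierPeriods.Zeta5Search.ClusterBoundProof
import HarnessLib

/-!
# ζ(5) search — THEOREM B (leading digit), part 1: binomial series, rescaling, and the near/far factorisation

Cell `pub-zeta5` (HONEST FRAMING: systematic search; no irrationality claim unless certified), typer seat
generation 8.  Part 1 of 2 of the Lean proof of gen-2 g6's THEOREM B (`ClusterValuation.LeadingDigit`; part 2 =
`LeadingDigitProof.lean`).  Contents (power-series algebra over `ℚ`, no primality used except `p ≠ 0`):

* the algebra of the statement file's `binomSeries δ e = Σ_j C(e,j) δ^{e−j} X^j` (`= (X + δ)^e` for every INTEGER `e`,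
  `δ ≠ 0`): `binomSeries δ 0 = 1`, `(X + δ)·binomSeries δ e = binomSeries δ (e+1)` (Pascal for `Ring.choose`),
  `(X + δ)^m · binomSeries δ e = binomSeries δ (e + m)`, `binomSeries δ (−m) = ((X + δ)^m)⁻¹`;
* rescaling `X ↦ aX` of linear factors and of inverses;
* the NEAR/FAR factorisation `Gser b q = Gnear b p q · Gfar b p q` of the regular part at the pole `q` (near = the other
  members of the residue class of `q`, and the centre factor when `p ∣ b₀ − 2q` with `b₀` odd);
* **`rescale_Gnear`**: `Gnear(−pX) = (−p)^{classExp q − netExp q} · classCofactor b p q` — the exact bridge between the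
  cell's regular part and gen-2's class cofactor `Φ_x`-data (`classRho`).
Nothing here is a cited fact; nothing concerns irrationality.
-/

noncomputable section

open Finset PowerSeries

namespace Summit.KontsevichZagierPeriods.Zeta5Search.ClusterValuation

open Summit.KontsevichZagierPeriods.Zeta5Search.DualSeries (InBox)
open Summit.KontsevichZagierPeriods.Zeta5Search.CasoratianValuation (InPolytope)

/-! ### The binomial series of the statement file -/

/-- Coefficients of `binomSeries`. -/
theorem coeff_binomSeries (δ : ℚ) (e : ℤ) (j : ℕ) :
    coeff j (binomSeries δ e) = (Ring.choose e j : ℚ) * δ ^ (e - j) := by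
  rw [binomSeries, coeff_mk]

/-- `binomSeries δ 0 = 1`. -/
theorem binomSeries_zero (δ : ℚ) : binomSeries δ 0 = 1 := by
  ext j
  rw [coeff_binomSeries, coeff_one, Int.cast_zero, Ring.choose_zero_ite ℚ]
  split_ifs with hj
  · subst hj; simp
  · simp

/-- **Pascal**: `(X + δ) · binomSeries δ e = binomSeries δ (e + 1)` (`δ ≠ 0`). -/
theorem linS_mul_binomSeries {δ : ℚ} (hδ : δ ≠ 0) (e : ℤ) :
    (X + C δ) * binomSeries δ e = binomSeries δ (e + 1) := by
  ext j
  rw [add_mul, map_add, coeff_C_mul, coeff_binomSeries, coeff_binomSeries]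
  rcases Nat.eq_zero_or_pos j with rfl | hj
  · rw [coeff_zero_X_mul, zero_add, Ring.choose_zero_right, Ring.choose_zero_right]
    push_cast
    rw [sub_zero, sub_zero, one_mul, one_mul, zpow_add_one₀ hδ, mul_comm]
  · obtain ⟨i, rfl⟩ : ∃ i, j = i + 1 := ⟨j - 1, by omega⟩
    rw [coeff_succ_X_mul, coeff_binomSeries]
    push_cast
    rw [Ring.choose_succ_succ]
    have e1 : δ * δ ^ (e - ((i : ℤ) + 1)) = δ ^ (e - i) := by
      rw [mul_comm, ← zpow_add_one₀ hδ]; congr 1; ring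
    have e2 : δ ^ (e + 1 - ((i : ℤ) + 1)) = δ ^ (e - i) := by congr 1; ring
    rw [e2, ← mul_assoc, mul_comm δ, mul_assoc, e1]
    ring

/-- `(X + δ)^m · binomSeries δ e = binomSeries δ (e + m)`. -/
theorem linS_pow_mul_binomSeries {δ : ℚ} (hδ : δ ≠ 0) (m : ℕ) (e : ℤ) :
    (X + C δ) ^ m * binomSeries δ e = binomSeries δ (e + m) := by
  induction m with
  | zero => simp
  | succ m ih =>
    rw [show e + ((m + 1 : ℕ) : ℤ) = (e + m) + 1 by push_cast; ring, ← linS_mul_binomSeries hδ, ← ih, pow_succ',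
      mul_assoc]

/-- For natural exponents the binomial series is the polynomial power: `binomSeries δ m = (X + δ)^m`. -/
theorem binomSeries_natCast {δ : ℚ} (hδ : δ ≠ 0) (m : ℕ) : binomSeries δ (m : ℤ) = (X + C δ) ^ m := by
  have := linS_pow_mul_binomSeries hδ m 0
  rw [binomSeries_zero, mul_one, zero_add] at this
  exact this.symm

/-- `binomSeries δ 1 = X + δ`. -/
theorem binomSeries_one {δ : ℚ} (hδ : δ ≠ 0) : binomSeries δ 1 = X + C δ := by
  have := linS_mul_binomSeries hδ 0
  rw [binomSeries_zero, mul_one, zero_add] at this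
  exact this.symm

/-- For negative exponents the binomial series is the inverse: `binomSeries δ (−m) = ((X + δ)^m)⁻¹`. -/
theorem binomSeries_neg {δ : ℚ} (hδ : δ ≠ 0) (m : ℕ) : binomSeries δ (-(m : ℤ)) = ((X + C δ) ^ m)⁻¹ := by
  have hc : constantCoeff ((X + C δ) ^ m : PowerSeries ℚ) ≠ 0 := by
    rw [map_pow, map_add, constantCoeff_X, constantCoeff_C, zero_add]; exact pow_ne_zero _ hδ
  rw [PowerSeries.eq_inv_iff_mul_eq_one hc, mul_comm, linS_pow_mul_binomSeries hδ m, neg_add_cancel, binomSeries_zero]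

/-- Combined: `(X + δ)^a · ((X + δ)^6)⁻¹ = binomSeries δ (a − 6)`. -/
theorem linS_pow_mul_inv_eq_binomSeries {δ : ℚ} (hδ : δ ≠ 0) (a : ℕ) :
    (X + C δ) ^ a * ((X + C δ) ^ 6)⁻¹ = binomSeries δ ((a : ℤ) - 6) := by
  rw [← binomSeries_neg hδ 6, linS_pow_mul_binomSeries hδ a]
  congr 1

/-! ### Rescaling -/

/-- `rescale a (C c) = C c`. -/
theorem rescale_C' (a c : ℚ) : rescale a (C c) = C c := by
  ext j; rw [coeff_rescale, coeff_C]; split_ifs with h <;> simp [h]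

/-- `rescale a (X + C δ) = C a · X + C δ`. -/
theorem rescale_X_add_C (a δ : ℚ) : rescale a (X + C δ) = C a * X + C δ := by
  rw [map_add, rescale_X, rescale_C']

/-- Rescaling commutes with inverses (non-zero constant coefficient). -/
theorem rescale_inv' (a : ℚ) (φ : PowerSeries ℚ) (h : constantCoeff φ ≠ 0) :
    rescale a φ⁻¹ = (rescale a φ)⁻¹ := by
  have h' : constantCoeff (rescale a φ) ≠ 0 := by
    rwa [← coeff_zero_eq_constantCoeff_apply, coeff_rescale, pow_zero, one_mul, coeff_zero_eq_constantCoeff_apply]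
  rw [PowerSeries.eq_inv_iff_mul_eq_one h', ← map_mul, PowerSeries.inv_mul_cancel _ h, map_one]

/-- `C a · X + C (a δ) = C a · (X + C δ)`. -/
theorem C_mul_X_add_C (a δ : ℚ) : C a * X + C (a * δ) = C a * (X + C δ) := by
  rw [map_mul]; ring

/-- Products of integer powers of a non-zero constant. -/
theorem prod_zpow_eq {ι : Type*} (s : Finset ι) (f : ι → ℤ) {a : ℚ} (ha : a ≠ 0) :
    ∏ i ∈ s, a ^ f i = a ^ (∑ i ∈ s, f i) := by
  classical
  induction s using Finset.induction_on with
  | empty => simp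
  | insert x s hx ih => rw [prod_insert hx, sum_insert hx, ih, zpow_add₀ ha]

/-! ### The near/far factorisation of the regular part -/

/-- The factor of the position `s` in `Gser b q`: `(X + (s−q))^{mult s} · ((X + (s−q))^6)⁻¹ = (X + (s−q))^{netExp s}`. -/
def factorS (b : ℕ → ℤ) (q s : ℕ) : PowerSeries ℚ :=
  linS ((s : ℚ) - q) ^ mult b s * (linS ((s : ℚ) - q) ^ 6)⁻¹

/-- The NEAR part: the other members of the residue class of `q`, and the centre factor `X + (b₀/2 − q)` when `b₀` is
odd and `p ∣ b₀ − 2q`. -/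
def Gnear (b : ℕ → ℤ) (p q : ℕ) : PowerSeries ℚ :=
  (if ¬ (2 : ℤ) ∣ b 0 ∧ CentreIn b p q then linS ((((b 0).toNat : ℕ) : ℚ) / 2 - q) else 1) *
    ∏ s ∈ (classSet b p q).erase q, factorS b q s

/-- The FAR part: the positions outside the class of `q`, the constant `2`, and the whole centre factor when it is
not near. -/
def Gfar (b : ℕ → ℤ) (p q : ℕ) : PowerSeries ℚ :=
  (if ¬ (2 : ℤ) ∣ b 0 ∧ CentreIn b p q then C 2 else (cenP b q : PowerSeries ℚ)) *
    ∏ s ∈ ((range ((b 0).toNat + 1)).erase q).filter (fun s : ℕ => ¬ (p : ℤ) ∣ (s : ℤ) - q), factorS b q s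

/-- **`Gser = Gnear · Gfar`.** -/
theorem Gser_eq_near_mul_far (b : ℕ → ℤ) (p q : ℕ) : Gser b q = Gnear b p q * Gfar b p q := by
  have hsplit : ∏ s ∈ (range ((b 0).toNat + 1)).erase q, factorS b q s =
      (∏ s ∈ (classSet b p q).erase q, factorS b q s) *
        ∏ s ∈ ((range ((b 0).toNat + 1)).erase q).filter (fun s : ℕ => ¬ (p : ℤ) ∣ (s : ℤ) - q), factorS b q s := by
    rw [← filter_dvd_eq_classSet_erase (p := p) b q, prod_filter_mul_prod_filter_not]
  have hG : Gser b q = (cenP b q : PowerSeries ℚ) * ∏ s ∈ (range ((b 0).toNat + 1)).erase q, factorS b q s := rfl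
  rw [hG, hsplit, Gnear, Gfar]
  by_cases hc : ¬ (2 : ℤ) ∣ b 0 ∧ CentreIn b p q
  · rw [if_pos hc, if_pos hc]
    have hcen : (cenP b q : PowerSeries ℚ) = C 2 * linS ((((b 0).toNat : ℕ) : ℚ) / 2 - q) := by
      rw [cenP, if_neg hc.1, Polynomial.coe_add, Polynomial.coe_mul, Polynomial.coe_C, Polynomial.coe_X,
        Polynomial.coe_C, linS, mul_add, ← map_mul]
      congr 2; ring
    rw [hcen]; ring
  · rw [if_neg hc, if_neg hc]; ring

/-! ### The near part rescaled is the class cofactor -/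

/-- One near factor rescaled: `factorS(−pX) = (−p)^{netExp s} · binomSeries ((q−s)/p) (netExp s)`. -/
theorem rescale_factorS {p : ℕ} (hp : p ≠ 0) (b : ℕ → ℤ) {q s : ℕ} (hsq : s ≠ q) :
    rescale (-(p : ℚ)) (factorS b q s) =
      C ((-(p : ℚ)) ^ netExp b s) * binomSeries (((q : ℚ) - s) / p) (netExp b s) := by
  have hp' : (-(p : ℚ)) ≠ 0 := neg_ne_zero.2 (Nat.cast_ne_zero.2 hp)
  set δ : ℚ := ((q : ℚ) - s) / p with hδ
  have hδ0 : δ ≠ 0 := by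
    rw [hδ]; exact div_ne_zero (sub_ne_zero.2 (by exact_mod_cast hsq.symm)) (Nat.cast_ne_zero.2 hp)
  have hlin : rescale (-(p : ℚ)) (linS ((s : ℚ) - q)) = C (-(p : ℚ)) * (X + C δ) := by
    rw [linS, rescale_X_add_C, ← C_mul_X_add_C]
    congr 2; rw [hδ]; field_simp; ring
  have hc6 : constantCoeff (linS ((s : ℚ) - q) ^ 6) ≠ 0 := by
    rw [constantCoeff_linS_pow]; exact pow_ne_zero _ (sub_ne_zero.2 (by exact_mod_cast hsq))
  have hcX : constantCoeff ((X + C δ) ^ 6 : PowerSeries ℚ) ≠ 0 := by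
    rw [map_pow, map_add, constantCoeff_X, constantCoeff_C, zero_add]; exact pow_ne_zero _ hδ0
  have hm : ((mult b s : ℕ) : ℤ) - 6 = netExp b s := by have := mult_eq_netExp b s; omega
  rw [factorS, map_mul, map_pow, rescale_inv' _ _ hc6, map_pow, hlin, mul_pow, mul_pow, PowerSeries.mul_inv_rev,
    ← map_pow, ← map_pow, PowerSeries.C_inv]
  -- rearrange and use the binomial series
  calc C ((-(p : ℚ)) ^ mult b s) * (X + C δ) ^ mult b s * (((X + C δ) ^ 6)⁻¹ * C (((-(p : ℚ)) ^ 6)⁻¹))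
      = C ((-(p : ℚ)) ^ mult b s * ((-(p : ℚ)) ^ 6)⁻¹) * ((X + C δ) ^ mult b s * ((X + C δ) ^ 6)⁻¹) := by
        rw [map_mul]; ring
    _ = C ((-(p : ℚ)) ^ ((mult b s : ℤ) - 6)) * binomSeries δ ((mult b s : ℤ) - 6) := by
        rw [linS_pow_mul_inv_eq_binomSeries hδ0, zpow_sub₀ hp', zpow_natCast, zpow_ofNat, div_eq_mul_inv]
    _ = _ := by rw [hm]

/-- The near exponent: `Σ_{s ∈ class∖q} netExp s + [odd centre in class] = classExp q − netExp q`. -/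
theorem nearExp_eq (b : ℕ → ℤ) {p q : ℕ} (hq : q ≤ (b 0).toNat) :
    (∑ s ∈ (classSet b p q).erase q, netExp b s) + (if ¬ (2 : ℤ) ∣ b 0 ∧ CentreIn b p q then 1 else 0) =
      classExp b p q - netExp b q := by
  have hqmem : q ∈ classSet b p q := mem_filter.2 ⟨mem_range.2 (by omega), rfl⟩
  rw [classExp, ← add_sum_erase _ _ hqmem]
  ring

/-- **The near part rescaled by `−p` is `(−p)^{classExp − netExp q}` times gen-2's class cofactor.** -/
theorem rescale_Gnear {p : ℕ} (hp : p ≠ 0) (b : ℕ → ℤ) (h0 : 0 ≤ b 0) {q : ℕ} (hq : q ≤ (b 0).toNat) :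
    rescale (-(p : ℚ)) (Gnear b p q) = C ((-(p : ℚ)) ^ (classExp b p q - netExp b q)) * classCofactor b p q := by
  have hp' : (-(p : ℚ)) ≠ 0 := neg_ne_zero.2 (Nat.cast_ne_zero.2 hp)
  have hb0 : ((((b 0).toNat : ℕ) : ℚ)) = ((b 0 : ℤ) : ℚ) := by exact_mod_cast Int.toNat_of_nonneg h0
  -- the product over the class
  have hprod : rescale (-(p : ℚ)) (∏ s ∈ (classSet b p q).erase q, factorS b q s) =
      C ((-(p : ℚ)) ^ ∑ s ∈ (classSet b p q).erase q, netExp b s) *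
        ∏ s ∈ (classSet b p q).erase q, binomSeries (((q : ℚ) - s) / p) (netExp b s) := by
    rw [map_prod, ← prod_zpow_eq _ _ hp', map_prod, ← prod_mul_distrib]
    exact prod_congr rfl fun s hs => rescale_factorS hp b (mem_erase.1 hs).1
  rw [Gnear, map_mul, hprod, ← nearExp_eq b hq, classCofactor]
  by_cases hc : ¬ (2 : ℤ) ∣ b 0 ∧ CentreIn b p q
  · have hδc : ((q : ℚ) - (b 0 : ℚ) / 2) / p ≠ 0 := by
      -- `(q − b₀/2)/p ≠ 0` for odd `b₀`
      intro h
      rw [div_eq_zero_iff] at h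
      rcases h with h | h
      · have : (2 * (q : ℤ) - b 0 : ℤ) = 0 := by
          have h2 : (2 * (q : ℚ) - (b 0 : ℚ)) = 0 := by linarith
          exact_mod_cast h2
        exact hc.1 ⟨q, by omega⟩
      · exact hp (by exact_mod_cast h)
    rw [if_pos hc, if_pos hc, if_pos hc, linS, rescale_X_add_C, zpow_add₀ hp', zpow_one, map_mul,
      binomSeries_one hδc]
    have : C (-(p : ℚ)) * X + C (((((b 0).toNat : ℕ) : ℚ)) / 2 - q) =
        C (-(p : ℚ)) * (X + C (((q : ℚ) - (b 0 : ℚ) / 2) / p)) := by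
      rw [← C_mul_X_add_C, hb0]; congr 2; field_simp; ring
    rw [this]; ring
  · rw [if_neg hc, if_neg hc, if_neg hc, map_one, one_mul, add_zero, mul_one]

end Summit.KontsevichZagierPeriods.Zeta5Search.ClusterValuation

end
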